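import Mathlib
import Literature.FieldTheory.Separability.PIndependentDerivations

/-!
# `PAlteration.PicoverToRadicialBottom`: relative `p`-bases

Route `ResolutionOfSingularities/pAlteration`, crux `PicoverToRadicialBottom`
(stmt-ResolutionOfSingularities-0556), line `theta-finite-cofinite-roots`, stub `stub_relPBasis`
(pure field theory). For a field `k` of characteristic `p` and a finite `C ⊆ k` there is a set
`S ⊆ k` with

* (S1) `k^p(S ∪ C) = k`, and
* (S2) no `b ∈ S` lies in `k^p(C ∪ (S ∖ {b}))`,

i.e. a `p`-basis of `k` relative to `k^p(C)` (Matsumura, *Commutative Ring Theory*, §26: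
`p`-independent sets extend to `p`-bases). Here `k^p(Y) = pAdjoin p Y` is the subfield generated
by the `p`-th powers and `Y` (`Literature.FieldTheory.Separability.pAdjoin`).

Proof: Zorn's lemma on the family of sets satisfying (S2) (chains: the subfield generated by a
directed union is the directed union of the generated subfields), and maximal elements satisfy
(S1) by the **exchange lemma** for `p`-th root extensions: if `M ⊇ k^p` is a subfield, `b ∉ M`
and `b ∈ M(a)`, then `a ∈ M(b)` (both `M(a)` and `M(b)` have degree `p` over `M`, the minimal
polynomial of `x ∉ M` being `X ^ p - x ^ p`).
-/

noncomputable section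

-- single-problem summit: the doubled namespace component `ResolutionOfSingularities` is forced
set_option linter.dupNamespace false

open Polynomial
open Literature.FieldTheory.Separability

namespace Summit.ResolutionOfSingularities.ResolutionOfSingularities.Theorems

section Exchange

variable {k : Type} [Field k] {p : ℕ} [Fact p.Prime] [CharP k p]

/-- For a subfield `M ⊇ k^p` (`p = char k`) and `a ∉ M`, the extension `M(a) / M` has degree `p`
(the minimal polynomial of `a` is `X ^ p - a ^ p`, irreducible as `a ^ p` is not a `p`-th power in
`M` by injectivity of Frobenius). [folklore] -/
private theorem finrank_adjoin_simple_eq_of_not_mem (M : Subfield k) (hM : ∀ x : k, x ^ p ∈ M)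
    {a : k} (ha : a ∉ M) : Module.finrank M (IntermediateField.adjoin M {a}) = p := by
  haveI : ExpChar k p := ExpChar.prime Fact.out
  have hp : p.Prime := Fact.out
  set c : M := ⟨a ^ p, hM a⟩ with hc
  have hmonic : (X ^ p - C c : M[X]).Monic := monic_X_pow_sub_C _ hp.ne_zero
  have haeval : aeval a (X ^ p - C c : M[X]) = 0 := by
    simp [hc, Subfield.algebraMap_ofSubfield]
  have hint : IsIntegral M a :=
    .of_pow hp.pos (isIntegral_algebraMap (R := M) (A := k) (x := c))
  have hirr : Irreducible (X ^ p - C c : M[X]) := by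
    refine X_pow_sub_C_irreducible_of_prime hp fun b hb => ha ?_
    have hba : (b : k) ^ p = a ^ p := by simpa [hc] using congrArg Subtype.val hb
    exact frobenius_inj k p hba ▸ b.2
  rw [IntermediateField.adjoin.finrank hint,
    ← minpoly.eq_of_irreducible_of_monic hirr haeval hmonic, natDegree_X_pow_sub_C]

/-- The subfield generated by a subfield `M` and an element `x` is `M(x)`. [folklore] -/
private theorem closure_insert_eq_adjoin (M : Subfield k) (x : k) :
    Subfield.closure (insert x (M : Set k)) = (IntermediateField.adjoin M {x}).toSubfield := by
  rw [IntermediateField.adjoin_toSubfield]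
  congr 1
  ext y
  simp [Subfield.algebraMap_ofSubfield]

/-- **Exchange lemma** for `p`-th root extensions: for a subfield `M ⊇ k^p` (`p = char k`),
if `b ∉ M` but `b ∈ M(a)`, then `a ∈ M(b)` (as `M < M(b) ≤ M(a)` and `[M(a) : M] = p` is
prime; here directly `[M(b) : M] = p = [M(a) : M]`). [folklore] -/
private theorem mem_closure_insert_of_mem_closure_insert (M : Subfield k)
    (hM : ∀ x : k, x ^ p ∈ M) {a b : k} (hb : b ∉ M)
    (hba : b ∈ Subfield.closure (insert a (M : Set k))) :
    a ∈ Subfield.closure (insert b (M : Set k)) := by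
  have ha : a ∉ M := by
    intro ha
    refine hb ((Subfield.closure_le (t := M)).mpr ?_ hba)
    exact Set.insert_subset ha subset_rfl
  rw [closure_insert_eq_adjoin] at hba ⊢
  have hba' : b ∈ IntermediateField.adjoin M {a} := hba
  have hle : IntermediateField.adjoin M {b} ≤ IntermediateField.adjoin M {a} :=
    IntermediateField.adjoin_simple_le_iff.mpr hba'
  have hint : IsIntegral M a :=
    .of_pow (Fact.out : p.Prime).pos
      (isIntegral_algebraMap (R := M) (A := k) (x := ⟨a ^ p, hM a⟩))
  haveI := IntermediateField.adjoin.finiteDimensional hint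
  have heq : IntermediateField.adjoin M {b} = IntermediateField.adjoin M {a} :=
    IntermediateField.eq_of_le_of_finrank_eq hle (by
      rw [finrank_adjoin_simple_eq_of_not_mem M hM ha,
        finrank_adjoin_simple_eq_of_not_mem M hM hb])
  change a ∈ IntermediateField.adjoin M {b}
  rw [heq]
  exact IntermediateField.mem_adjoin_simple_self M a

end Exchange

/-- **S2f (relative `p`-basis).** For a finite `C ⊆ k` (`char k = p`) there is `S ⊆ k` with
`k = k^p(S ∪ C)` and no `b ∈ S` in `k^p(C ∪ S ∖ {b})` (a `p`-basis of `k` over `k^p(C)`; Zorn).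
[folklore] -/
theorem stub_relPBasis : ∀ (p : ℕ) [Fact p.Prime] (k : Type) [Field k] [CharP k p]
    (C : Finset k), ∃ S : Set k, pAdjoin p (S ∪ ↑C) = ⊤ ∧
      ∀ b ∈ S, b ∉ pAdjoin p (↑C ∪ (S \ {b})) := by
  intro p _ k _ _ C
  classical
  -- the `p`-free sets relative to `C`
  set P : Set (Set k) := {S | ∀ b ∈ S, b ∉ pAdjoin p (↑C ∪ (S \ {b}))} with hP
  -- chains in `P` are bounded by their union
  have hchain : ∀ c ⊆ P, IsChain (· ⊆ ·) c → ∃ ub ∈ P, ∀ s ∈ c, s ⊆ ub := by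
    intro c hcP hc
    refine ⟨⋃₀ c, fun b hb hmem => ?_, fun s hs => Set.subset_sUnion_of_mem hs⟩
    obtain ⟨S₀, hS₀c, hbS₀⟩ := Set.mem_sUnion.mp hb
    haveI : Nonempty c := ⟨⟨S₀, hS₀c⟩⟩
    let F : c → Subfield k := fun S => pAdjoin p (↑C ∪ ((S : Set k) \ {b}))
    have hdir : Directed (· ≤ ·) F := by
      rintro ⟨S, hS⟩ ⟨T, hT⟩
      rcases hc.total hS hT with h | h
      · exact ⟨⟨T, hT⟩, pAdjoin_mono (by gcongr), le_rfl⟩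
      · exact ⟨⟨S, hS⟩, le_rfl, pAdjoin_mono (by gcongr)⟩
    have hle : pAdjoin p (↑C ∪ (⋃₀ c \ {b})) ≤ ⨆ i, F i := by
      rw [pAdjoin, Subfield.closure_le]
      rintro x (⟨y, rfl⟩ | hxC | ⟨hxU, hxb⟩)
      · exact le_iSup F ⟨S₀, hS₀c⟩ (frobenius_def (R := k) p y ▸ pow_mem_pAdjoin _ y)
      · exact le_iSup F ⟨S₀, hS₀c⟩ (subset_pAdjoin _ (Or.inl hxC))
      · obtain ⟨S, hSc, hxS⟩ := Set.mem_sUnion.mp hxU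
        exact le_iSup F ⟨S, hSc⟩ (subset_pAdjoin _ (Or.inr ⟨hxS, hxb⟩))
    obtain ⟨⟨S, hSc⟩, hbS⟩ := (Subfield.mem_iSup_of_directed hdir).mp (hle hmem)
    rcases hc.total hSc hS₀c with h | h
    · exact hcP hS₀c b hbS₀ (pAdjoin_mono (by gcongr) hbS)
    · exact hcP hSc b (h hbS₀) hbS
  obtain ⟨S, hSmax⟩ := zorn_subset P hchain
  refine ⟨S, ?_, hSmax.prop⟩
  -- maximal elements of `P` generate `k` over `k^p(C)`
  by_contra htop
  obtain ⟨a, ha⟩ : ∃ a, a ∉ pAdjoin p (S ∪ ↑C) := by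
    by_contra h
    push Not at h
    exact htop (eq_top_iff.mpr fun x _ => h x)
  have haS : a ∉ S := fun h => ha (subset_pAdjoin _ (Or.inl h))
  have hins : insert a S ∈ P := by
    intro b hb
    rcases Set.mem_insert_iff.mp hb with rfl | hbS
    · -- `b = a ∉ k^p(S ∪ C) ⊇ k^p(C ∪ ((S ∪ {a}) ∖ {a}))`
      intro hmem
      refine ha (pAdjoin_mono ?_ hmem)
      rintro x (hx | ⟨hx1, hx2⟩)
      · exact Or.inr hx
      · rcases Set.mem_insert_iff.mp hx1 with rfl | h
        · exact absurd rfl hx2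
        · exact Or.inl h
    · -- `b ∈ S`: exchange lemma over `M := k^p(C ∪ (S ∖ {b}))`
      intro hmem
      set M : Subfield k := pAdjoin p (↑C ∪ (S \ {b})) with hM
      have hbM : b ∉ M := hSmax.prop b hbS
      have hMp : ∀ x : k, x ^ p ∈ M := pow_mem_pAdjoin _
      have h1 : b ∈ Subfield.closure (insert a (M : Set k)) := by
        refine (Subfield.closure_le.mpr ?_ : pAdjoin p (↑C ∪ (insert a S \ {b})) ≤ _) hmem
        rintro x (⟨y, rfl⟩ | hxC | ⟨hx1, hx2⟩)
        · exact Subfield.subset_closure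
            (Set.mem_insert_of_mem _ (frobenius_def (R := k) p y ▸ pow_mem_pAdjoin _ y))
        · exact Subfield.subset_closure (Set.mem_insert_of_mem _ (subset_pAdjoin _ (Or.inl hxC)))
        · rcases Set.mem_insert_iff.mp hx1 with rfl | hxS
          · exact Subfield.subset_closure (Set.mem_insert _ _)
          · exact Subfield.subset_closure
              (Set.mem_insert_of_mem _ (subset_pAdjoin _ (Or.inr ⟨hxS, hx2⟩)))
      have h2 := mem_closure_insert_of_mem_closure_insert M hMp hbM h1
      refine ha (Subfield.closure_le.mpr ?_ h2)
      refine Set.insert_subset (subset_pAdjoin _ (Or.inl hbS)) ?_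
      exact pAdjoin_mono (by rintro x (hx | ⟨hx, _⟩); exacts [Or.inr hx, Or.inl hx])
  exact haS (hSmax.2 hins (Set.subset_insert a S) (Set.mem_insert a S))

end Summit.ResolutionOfSingularities.ResolutionOfSingularities.Theorems
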